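import Literature.AnabelianGeometry.AbsoluteAnabelian.ArchimedeanReconstruction
import HarnessLib

/-!
# [AbsTopIII] Cor 2.9 — two kernel READINGS of the statement of record `GlobalArchimedeanCompatibility`
# (proof-only; input for the L4 chart-package ruling on COR29-GLOBALISE)

S. Mochizuki, *Topics in absolute anabelian geometry III* [MochizukiAbsTopIII2015], Cor 2.9 (a)/(b),
kurims p. 64 l. 37 – p. 65 l. 34.  The cell's statement of record is the `Prop`-valued structure
`ArchimedeanReconstruction.GlobalArchimedeanCompatibility D L isNFPoint cot d vanishesAt scale fval`
(`ArchimedeanReconstruction.lean`, abc-iut-L4 lineage, p408225), a SCHEMA over the Cor 2.8 interface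
`NFCurveData` with the NF-point predicate, the cotangent data, the scaling datum and the value functions
as FREE parameters.  This PROOF-ONLY file (abc-iut-f-075, COR29-READ part 3/3 of L4-lead RULING #7y; no
definition, nothing restated) records two properties OF THE TYPING that bound what any instance of the
schema can certify — they were checked in the audit probe of `ArchimedeanReconstructionCor29Globalise.lean`
(p436603) and are landed here so the ruling can cite tree declarations:

* `GlobalArchimedeanCompatibility.of_forall_not` — **READING 1 (vacuity at an empty NF-point predicate)**:
  every clause quantifies over `isNFPoint x`, so at a predicate with no points the statement holds for EVERY
  datum `D`, EVERY `L` and EVERY choice of the remaining parameters.  An instance is contentful exactly at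
  the inhabited part of `isNFPoint`.
* `LocalLinearHolStructure.exists_transCompatible_unitsIso` and
  `GlobalArchimedeanCompatibility.units_iso_of_unitsEquiv` — **READING 2 (clause (b) is interface-level)**:
  the interface `LocalLinearHolStructure` CARRIES `isoUnits : ℂˣ ≃ₜ* 𝒜_p` with `trans`-compatibility
  (`trans_isoUnits`; the docstring of `HolomorphicCores.lean` says the printed compatibility "with the
  topological field structures on `𝒜_p ∪ {0}`" is deliberately not recorded), hence for ANY `L` and ANY
  identification of topological groups `κu : ℂˣ ≃ₜ* k_vˣ` the family `e x := (L.isoUnits x)⁻¹ ≫ κu` is a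
  `trans`-compatible family `𝒜_x ≃ₜ* k_vˣ` — clause (b) AS TYPED carries exactly «`k_vˣ ≅ ℂˣ` as
  topological groups», independently of the charts, of `ι`, and of which `L` is used.

HONEST LABEL: statements about OUR typing (schema hygiene), not about print — print's (b) («the resulting
`ι_{U_X,x}` determine an isomorphism of topological fields `𝒜_x ∪ {0} ⥲ k_v` via the condition of
compatibility with the natural actions», p. 65 l. 17–22) is stronger than the typed clause.  Nothing here
bears on the disputed [IUTchIII] Cor. 3.12; no side taken; typed ≠ proved.
-/

noncomputable section

namespace Literature.AnabelianGeometry.AbsoluteAnabelian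

universe u

/-! ### READING 2, interface half: `trans`-compatible units identifications exist for every `L` -/

namespace LocalLinearHolStructure

variable {U : Type u} (L : LocalLinearHolStructure U)

/-- For a local linear holomorphic structure `L` (which carries `isoUnits : ℂˣ ≃ₜ* 𝒜_p`), the composite
`(isoUnits x)⁻¹ ≫ κu` with ANY `κu : ℂˣ ≃ₜ* G` is compatible with the transition isomorphisms:
`trans_{x₁,x₂} ≫ e_{x₂} = e_{x₁}`. [cite: MochizukiAbsTopIII2015, Proposition 2.6 pp.57–58] -/
theorem isoUnits_symm_trans_compatible {G : Type*} [Group G] [TopologicalSpace G] (κu : ℂˣ ≃ₜ* G)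
    (x₁ x₂ : U) :
    (L.trans x₁ x₂).trans ((L.isoUnits x₂).symm.trans κu) = (L.isoUnits x₁).symm.trans κu := by
  have h := L.trans_isoUnits x₁ x₂
  ext a
  simp only [ContinuousMulEquiv.trans_apply]
  have ha := congrArg (fun f : ℂˣ ≃ₜ* L.A x₂ => f ((L.isoUnits x₁).symm a)) h
  simp only [ContinuousMulEquiv.trans_apply, ContinuousMulEquiv.apply_symm_apply] at ha
  rw [ha, ContinuousMulEquiv.symm_apply_apply]

/-- **READING 2 (interface half).**  Every `L : LocalLinearHolStructure U` admits, for every topological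
group `G` identified with `ℂˣ`, a `trans`-compatible family of identifications `𝒜_x ≃ₜ* G` — with no
hypothesis on `U`, on charts, or on points. [cite: MochizukiAbsTopIII2015, Proposition 2.6 pp.57–58] -/
theorem exists_transCompatible_unitsIso {G : Type u} [Group G] [TopologicalSpace G]
    (κu : ℂˣ ≃ₜ* G) :
    ∃ e : ∀ x : U, L.A x ≃ₜ* G, ∀ x₁ x₂, (L.trans x₁ x₂).trans (e x₂) = e x₁ :=
  ⟨fun x => (L.isoUnits x).symm.trans κu, fun x₁ x₂ => L.isoUnits_symm_trans_compatible κu x₁ x₂⟩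

end LocalLinearHolStructure

namespace ArchimedeanReconstruction

open _root_.Filter _root_.Topology

variable (D : NFCurveData)

/-! ### READING 1: vacuity at an empty NF-point predicate -/

/-- **READING 1.**  If the NF-point predicate has no points, the statement of record of Cor 2.9 holds for
EVERY datum `D`, every `L`, and every choice of the cotangent data, vanishing predicate, scaling datum and
value functions — all three clauses quantify over NF-points.  (So an instance of the schema is contentful
exactly on the inhabited part of `isNFPoint`.) [cite: MochizukiAbsTopIII2015, Corollary 2.9 pp.64–65] -/
theorem GlobalArchimedeanCompatibility.of_forall_not (L : LocalLinearHolStructure D.Xtop)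
    (isNFPoint : D.Xtop → Prop) (hempty : ∀ x, ¬ isNFPoint x) (cot : D.Xtop → Type)
    [∀ x, AddCommGroup (cot x)] [∀ x, Module D.kv (cot x)] (d : ∀ x, D.Fn → cot x)
    (vanishesAt : D.Fn → D.Xtop → Prop) (scale : D.Xtop → ℕ → D.Xtop → D.Xtop)
    (fval : D.Fn → D.Xtop → D.kv) :
    GlobalArchimedeanCompatibility D L isNFPoint cot d vanishesAt scale fval :=
  ⟨fun x h => (hempty x h).elim, fun x h => (hempty x h).elim,
    ⟨fun x h => (hempty x h).elim, fun x _ h _ => (hempty x h).elim⟩⟩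

/-- READING 1 at the literally empty predicate `fun _ ↦ False`.
[cite: MochizukiAbsTopIII2015, Corollary 2.9 pp.64–65] -/
theorem GlobalArchimedeanCompatibility.at_false (L : LocalLinearHolStructure D.Xtop) (cot : D.Xtop → Type)
    [∀ x, AddCommGroup (cot x)] [∀ x, Module D.kv (cot x)] (d : ∀ x, D.Fn → cot x)
    (vanishesAt : D.Fn → D.Xtop → Prop) (scale : D.Xtop → ℕ → D.Xtop → D.Xtop)
    (fval : D.Fn → D.Xtop → D.kv) :
    GlobalArchimedeanCompatibility D L (fun _ => False) cot d vanishesAt scale fval :=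
  GlobalArchimedeanCompatibility.of_forall_not D L _ (fun _ h => h) cot d vanishesAt scale fval

/-! ### READING 2: clause (b) of the statement of record from a bare units identification -/

/-- **READING 2 (statement-of-record half).**  Clause (b) `units_iso` of `GlobalArchimedeanCompatibility`
— "a `trans`-compatible family of continuous multiplicative isomorphisms `𝒜_x ≃ k_vˣ` at the NF-points" —
holds for EVERY `L`, EVERY NF-point predicate and EVERY datum as soon as `k_vˣ ≅ ℂˣ` as topological groups;
it does not involve the charts, the functionals `ι`, or the values.  (Print's (b) — the isomorphism of
topological FIELDS `𝒜_x ∪ {0} ⥲ k_v` "via the condition of compatibility [with respect to the `ι_{U_X,x}`]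
with the natural actions", p. 65 l. 17–22 — is stronger than the typed clause.)
[cite: MochizukiAbsTopIII2015, Corollary 2.9 (b) p.65] -/
theorem GlobalArchimedeanCompatibility.units_iso_of_unitsEquiv (L : LocalLinearHolStructure D.Xtop)
    (isNFPoint : D.Xtop → Prop) (κu : ℂˣ ≃ₜ* (D.kv)ˣ) :
    ∃ e : ∀ x, isNFPoint x → (L.A x ≃ₜ* (D.kv)ˣ),
      ∀ x₁ x₂ (h₁ : isNFPoint x₁) (h₂ : isNFPoint x₂), (L.trans x₁ x₂).trans (e x₂ h₂) = e x₁ h₁ := by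
  obtain ⟨e, he⟩ := L.exists_transCompatible_unitsIso κu
  exact ⟨fun x _ => e x, fun x₁ x₂ _ _ => he x₁ x₂⟩

/-- Hence: given clauses (a) (`limit_depends_on_differential`, `embedding`) and a bare `κu : ℂˣ ≃ₜ* k_vˣ`,
the full statement of record follows — clause (b) is never the obstruction.
[cite: MochizukiAbsTopIII2015, Corollary 2.9 pp.64–65] -/
theorem GlobalArchimedeanCompatibility.of_clauses_a_of_unitsEquiv (L : LocalLinearHolStructure D.Xtop)
    (isNFPoint : D.Xtop → Prop) (cot : D.Xtop → Type) [∀ x, AddCommGroup (cot x)]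
    [∀ x, Module D.kv (cot x)] (d : ∀ x, D.Fn → cot x) (vanishesAt : D.Fn → D.Xtop → Prop)
    (scale : D.Xtop → ℕ → D.Xtop → D.Xtop) (fval : D.Fn → D.Xtop → D.kv) (κu : ℂˣ ≃ₜ* (D.kv)ˣ)
    (ha₁ : ∀ x, isNFPoint x → ∀ f g : D.Fn, vanishesAt f x → vanishesAt g x → d x f = d x g →
      ∀ v : D.Xtop, ∀ a : D.kv,
        Tendsto (fun n : ℕ => (n : D.kv) * fval f (scale x n v)) atTop (𝓝 a) →
        Tendsto (fun n : ℕ => (n : D.kv) * fval g (scale x n v)) atTop (𝓝 a))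
    (ha₂ : ∀ x, isNFPoint x → ∃ (UX : TopologicalSpace.Opens D.Xtop) (ι : UX → (cot x →ₗ[D.kv] D.kv)),
      x ∈ UX ∧ Function.Injective ι ∧
      ∀ (v : UX) (f : D.Fn), vanishesAt f x →
        Tendsto (fun n : ℕ => (n : D.kv) * fval f (scale x n v)) atTop (𝓝 (ι v (d x f)))) :
    GlobalArchimedeanCompatibility D L isNFPoint cot d vanishesAt scale fval :=
  ⟨ha₁, ha₂, GlobalArchimedeanCompatibility.units_iso_of_unitsEquiv D L isNFPoint κu⟩

end ArchimedeanReconstruction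

end Literature.AnabelianGeometry.AbsoluteAnabelian

end
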